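import Literature.MathematicalPhysics.QuantumFieldTheory.Balaban1983to89.Node00.Record12BgRowCoClassCPM
import Literature.MathematicalPhysics.QuantumFieldTheory.Balaban1983to89.Node00.CriticalOnFibreGauge

/-!
# NODE 00 — ROW P11 UNDER F7 ∕ v1.6: THE GAUGE SENTENCE OF [15] THEOREM 1 — (9) LINE 1 IN ∃-GAUGE FORM AS A NAMED FACT
# `VariationalThm1GaugeRegSepTop7M F N Sup M B₃ B₃' a₀ a₁` ∕ `VariationalThm1GaugeRegSepCoP7M F N M B₃ B₃' a₀ a₁`, the row body keyed on handed-over gauges, and the composite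

Cell `pub-ymgap`, seat `pub-ymgap-node00-def-P11` g8 (R218 ∕ OPS-NOTE-16; pen of record for the [15]-fact leaves).  Repair (ρ1)+(ρ2′) of dag-n07-e's
LOCATED-M6 (cell bus INBOX l.19686, 2026-08-27; ANSWER-M6 + INTENT-14 l.19773).  v1.1 (same day, replacing v1.0 p532745 before any consumer keyed on it): the
sentence carries print's NON-WRAPPING letter per cube family (dag-n07-e FILED-23 (Δ2), l.19920) and §4 derives it from dag-n07-e's step fact `Gauge9RegSepTopStep`.
[15] = [Balaban1985Variational]; [6] = [Balaban1985RegularSpaces]; [III] = [Balaban1988Convergent]; [I] = [Balaban1987RG1].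

WHY THIS FILE EXISTS (LOCATED-M6, concurred by the author of FILE 13).  FILE 13 (`Record12BgRowCoClassC1`) named the second [15] sentence of the K0 road as
`VariationalThm1C1RegSep{Top7M,CoP7M}`, whose conclusion `PlaqC1SmallOn (plaqInside (s.Ω n)) (B₃'·δ_n·η_n³) U₀` (adjacent plaquette variables of the minimiser differ,
after transport, by `O(δ_nη_n³)`) is a SUP bound on the covariant lattice derivative of the curvature.  Print does NOT give that: [15] Thm 1 (9) p. 279 bounds `|A|`,
`|∇^ηA|` (sup) and a β-Hölder seminorm of `∇^ηA` (`β ≤ β₀ < 1`), (10) bounds only the two second-order OPERATORS `|∂^{η*}∂^ηA|, |Δ^ηA|`; [6] CMP 99 p. 83 l. 1–9: «such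
information is unavailable for the second order derivatives».  So FILE 13's two `Prop`s are PRINT-STRONGER than (9)–(10) (they stay landed, never asserted; no count line cites
them).  What [I] (1.12) ∕ [III] (2.38)(ii) actually ask of the background is an EXISTENTIAL local gauge — `CondI.localGauge` ∕ `CondII238.localGauge` are literally
`∃ u, … ∃ A, U^u = e^{iξA} ∧ |A| < … ∧ |∇^ξA| < …` — and print's witness for the backgrounds `U_k(𝔟_k)` ([III] (2.27)–(2.28) p. 259) is the gauge `u` OF [15] (9) itself.
This file therefore (ρ1) names (9) LINE 1 in that ∃-gauge form as the second cited sentence, and (ρ2′) re-keys ROW P11's body on handed-over gauges instead of the axial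
potential's displayed derivative members `h3I`∕`h3MS` (FILES 4∕5∕7a–c∕10∕12a∕13), whose comb-gauge gradient lemma needed exactly the unprinted `η³` datum.

THE CLAUSE (§0).  `Sect2.LocalGaugeOn Y ξ t U` := `∃ u : GaugeTransf P 0 (SU N), ∃ A : PBond P 0 → M_N(ℂ)`, on the region of the site set `Y` (`Sect2.regionOfSet`):
`(ι∘U)^{ι∘u}(b) = e^{iξA(b)}` on its bonds, `‖A(b)‖ < t` on its bonds, `‖∇^ξ_μ A_ν(x)‖ < t` on its derivative pairs — [I] (1.12)'s `localGauge` clause on ONE cube with an honest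
`SU(N)`-valued `u`, thresholds displayed.  Monotone in `Y` (restriction) and in `t`.

THE SENTENCE (§1, §3).  ★★ `VariationalThm1GaugeRegSepTop7M F N Sup M B₃ B₃' a₀ a₁` := FILE 12d's `VariationalThm1RegSepTop7M F N Sup B₃ a₀ a₁` binder block BYTE FOR
BYTE with ONE delta — the cube letter `M` of the (2.18) index `s : SeqOfRecord F ν M g K k` is a PARAMETER of the `Prop` (print: the constant of (9) is `B₃·M`, linear in the
cube-size letter; here `B₃'` absorbs it, so the `Prop` is stated per `M`) — i.e. separated `s`, `0 < ν.M₁`, `0 < δ_n ≤ a₁ ∧ B₃δ_n ≤ ε₀`, `δ_n ≤ 2δ_{n+1}` and `δ_{n+1} ≤ 2δ_n`,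
`ε₀ ≤ a₀`, print's (7) on the datum over the support (`Sect2.DataSmall7PTop`), EVERY minimiser `U₀` over the top-domain class (6) at `ε₀`; CONCLUSION: at every scale
`1 ≤ n ≤ k`, (MS-family = the [III] (2.38) cubes) every `M`-cube of `T⁽ⁿ⁾` lying in `Ω_n` (`cubeEnl (F.P K) (side L M n) a 0 ⊆ s.Ω n`) and (I-family = the [I] (1.12)
cubes) every `LM`-cube of `T⁽ⁿ⁾` lying in `Ω_n` (`side L M (n+1)`) carries `Sect2.LocalGaugeOn □ η_n (B₃'·δ_n) U₀` — print's (9) line 1 «U^u = e^{iηA}, |A| < B₃Mε₁(L^jη)⁻¹,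
|∇^ηA| < B₃Mε₁(L^jη)⁻²» in the units `L^jη = 1` of the cube's own scale (print's `j` = our `n`, `ε₁ ↦ δ_n`) — each family UNDER PRINT'S NON-WRAPPING LETTER
`(side : ℤ) < sitesPerDir 0` (print's cubes are cubes of `T_η`, never wrapping the torus; on a wrapping «cube» the ∃-gauge sentence is false through the torus holonomy —
a flat abelian configuration with Polyakov loop far from `1` is a zero-action minimiser whose every gauge has `Σ_b η_n‖A(b)‖ ≳ 1` along the loop; dag-n07-e FILED-23 (Δ2);
the row body already holds the letter as FILE 12a's `hsN`).  ★★ `VariationalThm1GaugeRegSepCoP7M F N M B₃ B₃' a₀ a₁` := it at `Sup := suppDomOfRecord` (v1.5∕v1.6 `CoP`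
selector of record; definitional).

HONEST LABEL.  Verbatim (9) line 1 modulo: units; the NAMED ABSORPTIONS into `B₃'` of print's `B₃·M` (MS cubes: `M` units of `T⁽ⁿ⁾`; print's class cubes have size
`2ML^jη`, `M ≤ M(ε₁) = R₁M₁(a₁∕ε₁)`) resp. `B₃·LM` (I cubes), and of the one-scale factor `≤ 2L³` for cubes in the collar of `Ω_n` covered only by scale-`(n−1)` class
cubes (print's class cubes of scale `n` have their `2R₁M₁Lⁿη`-enlargement inside `Ω_n ∖ Ω_{n+2}`; in the collar, (9) at scale `n−1` gives `|A| < B₃(ML)δ_{n−1}·L`, `|∇A| <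
B₃(ML)δ_{n−1}·L²` in scale-`n` units, and `δ_{n−1} ≤ 2δ_n`) — so `B₃'` depends on `d, L, M`; and the READING, which is [III]'s own ((2.27)–(2.28) p. 259: «U_k(𝔟_k)
restricted to … belongs to Ũ^c_j(X, …)», whose condition (ii) (2.38) IS this ∃-gauge on every `CML^nξ`-cube `□ ⊂ Ω_n` of the step-`j` frame, `n ≤ j ≤ k`), that the
depth-`k` minimiser admits ONE such gauge on every cube of these two families inside `Ω_n`, including cubes of the top layer of a step frame that meet finer domains
`Ω_{n'}`, `n' > n` (print's class cubes of scale `n` lie in `Ω_n ∖ Ω_{n+2}`; deeper class cubes have the smaller thresholds `δ_{n'}(L^{n'}η)⁻¹ ≤ δ_n(L^nη)⁻¹` in absolute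
units by `δ_{n'} ≤ 2^{n'−n}δ_n ≤ L^{n'−n}δ_n`, two-sided comparability).  NO Hölder member, NO (10), NO curvature derivative.  The facts are `Prop`s with parameters,
NEVER asserted here; orbit uniqueness is not part of them.  Expected inhabitation floor (print: «positive constants»): `0 < B₃'` — at `B₃' ≤ 0` the conclusion
`‖A b‖ < B₃'δ_n ≤ 0` fails as soon as a minimiser exists and `Ω_n` holds one cube with a bond; consumers take `0 ≤ B₃'`.  Companion (8)-sentence floor: `2L² ≤ B₃`.

CONTENTS.  §0 `Sect2.LocalGaugeOn` (def), `.anti` (restriction), `.of_le`; the rescaling glue from scale-`n` units to the step-`j` currency of [III] (2.38)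
(`A ↦ L^{j−n}·A`: `expI_smul_real`, `eta_mul_L_pow`, `L_pow_mul_eta_mul_L_pow`, `grad_smul_const`, `Sect2.LocalGaugeOn.rescale`); `localGauge_cubesI_of_localGaugeOn`
(FILE 4's `localGauge_cubesI_of_classBound` OUTPUT TYPE from the I-family — no axial gauge, no chart, no wrapping letter) and `condII238_cubesMS_of_localGaugeOn`
(FILE 4's `condII238_cubesMS_of_classBounds` OUTPUT TYPE from the MS-family).  §1 ★★ `VariationalThm1GaugeRegSepTop7M` (def), `.of_le`, `.mono`.  §2 ★★
`bgRowAtDatumU_of_classBoundsPos_of_localGauge` — FILE 12a's `bgRowAtDatumU_of_classBoundsPos` with the axial-potential derivative members `h3I`∕`h3MS` and the four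
axial letters `hsN`∕`hcB`∕`hBCM`∕`hsmallI`∕`hsmallMS` REPLACED by the two handed-over gauge families `hgMS`∕`hgI` at a displayed threshold `t_n` and the two radius
letters `t_n ≤ O(1)LMB·α₀(g_n)`, `t_n ≤ BCM·α₀(g_n)` ((1.11)∕(2.34) plaquette clauses still from the class bound (8)); `localGaugeOn_of_thm1GaugeRegSepTop7M`; ★★★
`bgRowAtDatumU_of_thm1RegSepTop7M_of_thm1Gauge` — ROW P11's body for every minimiser over the top class from the TWO cited sentences ((8) = 12d, (9) line 1 = §1)
+ proved glue; no C¹ clause, no axial potential, no FILE 7c letters; `gaugeLetter_of_numerics` (the two radius letters from «C₀ sufficiently large», FILE 2 §1).  §3 ★★ `VariationalThm1GaugeRegSepCoP7M` (def), `.toTop7M` ∕ `….toCoP7M`, `.of_le`, `.mono`,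
★ `localGaugeOn_UbgMSCoPOfRecord_of_thm1GaugeRegSepCoP7M`, ★★★ `bgRowAtDatumCoP_of_thm1RegSepCoP7M_of_thm1Gauge` — ROW P11's body at node00-def-R's collar-class
minimiser `UbgMSCoPOfRecord … s 𝐖` (the v1.5∕v1.6 `bg` supplier's shape: `by_cases` on the solvable set, junk `1` off it).  §4 ★ `variationalThm1GaugeRegSepTop7M_of_gauge9TopStep`,
★ `variationalThm1GaugeRegSepCoP7M_of_gauge9TopStep` — the sentence from dag-n07-e's STEP fact `Gauge9RegSepTopStep` ((9) line 1 for critical configurations, `1 ≤ k`; minimal ⇒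
critical; `k = 0` vacuous here), the analogue of `…N07Thm1Top7FromProp8`'s bridge for the (8)-sentence; upstream of it dag-n07-e's `Gauge152OfClassTopStep` ([15] (152) = [6] Thm 2
applied locally) via `gauge9RegSepTopStep_of_prop8TopStep_of_gauge152`.

HONEST FRAMING.  Statement architecture + bookkeeping + elementary rescaling identities around TWO NAMED FACTS (`Prop`s, NEVER asserted); nothing of Bałaban asserted or
discharged; K0⁶ NOT closed; counts unmoved; one finite `𝕋⁴` torus family at fixed `ε = L^{−K}`; not continuum ∕ OS ∕ mass gap ∕ Clay.  Three `def`s, no `instance`,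
no `sorry`.  New leaf: nothing landed is edited; FILE 13 and node00-def-K0a's 16d compile unchanged.

DEPENDENCES (by name): dag-n07-e `Node00.CriticalOnFibreGauge` (`Gauge9RegSepTopStep`, `gauge9_of_isMinimizer_classTop_of_gauge9TopStep`; p532575), FILE 12d
`Node00.Record12BgRowCoClassCPM` (`VariationalThm1RegSepTop7M`, `VariationalThm1RegSepCoP7M`, `plaqSmallOn_of_thm1RegSepTop7M`),
FILE 12a `Node00.Record12BgRowTopDomain` (`Sect2.omegaPlaqsTop_of_ne_zero`, `Sect2.CoDivClassOnTop`, `Sect2.DataSmall7PTop`), FILE 10 `Node00.Record12BgRowCoClass`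
(`ofBackgroundC_mem_spaceI_of_classBoundU`, `ofBackgroundC_mem_spaceMS_of_classBoundU`, `bgRowAtDatum_one`), FILE 5 `Node00.Record12BgRowCubeGeometry`
(`hcubeΩ_of_compatible`), FILE 4 `Node00.Record12BgRowGaugeAxial` (`gaugeU_ιSU`, `L_pow_mul_eta`), node00-def-R FILE 22′ `Node00.LargeFieldBackgroundCoPOfRecord`
(`suppDomOfRecord`, `regMSCoPOfRecord`, `UbgMSCoPOfRecord`, `isMinimizer_UbgMSCoPOfRecord`, `UbgMSCoPOfRecord_eq_one_of_not_mem`), r11 `CondII238`, `MSConsts.ofParams`,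
`rad238`, `IsMinimizer`, `avOfRecord`, `genSet`, `epsOfRecord`, FILE 1 v1.1 `Sect2.SeqSeparated`, FILE 2 §1 `mul_eps_le_mul_alpha0`∕`one_le_log_inv_sq`, `Node00.Record11.ιSU_mem_G`.
-/

noncomputable section

open MeasureTheory
open scoped Matrix.Norms.L2Operator

namespace Literature.MathematicalPhysics.QuantumFieldTheory.Balaban1983to89.Node00

open T4Continuum B14.Eq218Concrete B15DeterminingSets B12RegularSpaces111 B14RegularSpaces234 B14Radii T4AxialGaugeSmallField

/-! ## §0  The ∃-gauge clause on one cube ([15] (9) line 1 ∕ [I] (1.12) ∕ [III] (2.38)(ii)), restriction, rescaling to the step currency, the two frame lemmas -/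

section GaugeClause

variable {N : ℕ} {P : Params}

/-- **THE LOCAL-GAUGE CLAUSE ON A SITE SET `Y` AT LATTICE UNIT `ξ` AND THRESHOLD `t`** for an `SU(N)` configuration `U`: there is an `SU(N)`-valued gauge transformation `u`
and a potential `A : bonds → M_N(ℂ)` with `(ι∘U)^{ι∘u}(b) = e^{iξA(b)}` on the bonds of `Y`, `‖A(b)‖ < t` there, and `‖∇^ξ_μ A_ν(x)‖ < t` on the derivative pairs of `Y`
(region structure `Sect2.regionOfSet`).  This is [I] (1.12)'s `localGauge` clause («there exists a G-valued gauge transformation u defined on □ and such, that U^u = exp iξA,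
|A|, |∇^ξA| < …») on ONE cube, = [15] Thm 1 (9) line 1 in ∃-form. [cite: Balaban1987RG1, (1.12) p.262; Balaban1985Variational, Thm 1 (9) p.279; Balaban1988Convergent, (2.38) p.261] -/
def Sect2.LocalGaugeOn (Y : Set (Site P 0)) (ξ t : ℝ) (U : GaugeField P 0 (SU N)) : Prop :=
  ∃ u : GaugeTransf P 0 (SU N), ∃ A : PBond P 0 → MatA N,
    (∀ b ∈ (Sect2.regionOfSet P Y).bonds, gaugeU (fun x => ιSU N (u x)) (fun b' => ιSU N (U b')) b = expI ξ (A b)) ∧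
    (∀ b ∈ (Sect2.regionOfSet P Y).bonds, ‖A b‖ < t) ∧
    ∀ q ∈ (Sect2.regionOfSet P Y).dpairs, ‖grad ξ q.2.1 (fun y => A ⟨y, q.2.2⟩) q.1‖ < t

/-- Restriction: the clause on `Y` gives the clause on every `Y' ⊆ Y` (same `u`, same `A`; the region structure is monotone). [cite: Balaban1987RG1, (1.12) p.262 (bookkeeping)] -/
theorem Sect2.LocalGaugeOn.anti {Y Y' : Set (Site P 0)} {ξ t : ℝ} {U : GaugeField P 0 (SU N)} (h : Sect2.LocalGaugeOn Y ξ t U) (hY : Y' ⊆ Y) :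
    Sect2.LocalGaugeOn Y' ξ t U := by
  obtain ⟨u, A, he, hA, hdA⟩ := h
  exact ⟨u, A, fun b hb => he b ⟨hY hb.1, hY hb.2⟩, fun b hb => hA b ⟨hY hb.1, hY hb.2⟩,
    fun q hq => hdA q ⟨hY hq.1, hY hq.2.1, hY hq.2.2.1, hY hq.2.2.2⟩⟩

/-- Monotone in the threshold. [cite: Balaban1987RG1, (1.12) p.262 (bookkeeping)] -/
theorem Sect2.LocalGaugeOn.of_le {Y : Set (Site P 0)} {ξ t t' : ℝ} {U : GaugeField P 0 (SU N)} (h : Sect2.LocalGaugeOn Y ξ t U) (ht : t ≤ t') :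
    Sect2.LocalGaugeOn Y ξ t' U := by
  obtain ⟨u, A, he, hA, hdA⟩ := h
  exact ⟨u, A, he, fun b hb => (hA b hb).trans_le ht, fun q hq => (hdA q hq).trans_le ht⟩

/-- `e^{iξ(c·a)} = e^{i(ξc)a}` for a real scalar `c` (the unit change `A ↦ c·A`). [cite: Balaban1987RG1, (1.13) p.262 (bookkeeping)] -/
theorem expI_smul_real {𝔸 : Type*} [NormedRing 𝔸] [NormedAlgebra ℂ 𝔸] [CompleteSpace 𝔸] (ξ c : ℝ) (a : 𝔸) :
    expI ξ ((c : ℂ) • a) = expI (ξ * c) a := by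
  unfold expI
  rw [smul_smul]
  congr 1
  push_cast
  ring_nf

/-- `η_j · L^{j−n} = η_n` for `n ≤ j` (`η_m = L^{−m}`). [cite: Balaban1987RG1, (1.1) p.260 (bookkeeping)] -/
theorem eta_mul_L_pow {n j : ℕ} (hn : n ≤ j) : P.eta j * (P.L : ℝ) ^ (j - n) = P.eta n := by
  have hL : (P.L : ℝ) ≠ 0 := Sect2.L_cast_ne_zero P
  obtain ⟨m, rfl⟩ := Nat.exists_eq_add_of_le hn
  unfold Params.eta
  rw [Nat.add_sub_cancel_left, pow_add, mul_assoc, ← mul_pow, inv_mul_cancel₀ hL, one_pow, mul_one]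

/-- `Lⁿ·η_j·L^{j−n} = 1` for `n ≤ j`. [cite: Balaban1987RG1, (1.1) p.260 (bookkeeping)] -/
theorem L_pow_mul_eta_mul_L_pow {n j : ℕ} (hn : n ≤ j) : (P.L : ℝ) ^ n * P.eta j * (P.L : ℝ) ^ (j - n) = 1 := by
  rw [mul_assoc, eta_mul_L_pow hn, L_pow_mul_eta]

/-- The lattice derivative of a rescaled potential at a rescaled unit: `∇^{ξ}_μ (c·A)(x) = (ξ⁻¹·c·ξ')·∇^{ξ'}_μ A(x)` (`ξ' ≠ 0`). [cite: Balaban1987RG1, (1.12) p.262 (bookkeeping)] -/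
theorem grad_smul_const {𝔸 : Type*} [NormedRing 𝔸] [NormedAlgebra ℂ 𝔸] {ξ ξ' : ℝ} (hξ' : ξ' ≠ 0) (c : ℝ) (μ : Fin P.d) (G : Site P 0 → 𝔸) (x : Site P 0) :
    grad ξ μ (fun y => (c : ℂ) • G y) x = ((ξ⁻¹ * c * ξ' : ℝ) : ℂ) • grad ξ' μ G x := by
  unfold grad
  have hξ'c : (ξ' : ℂ) ≠ 0 := by exact_mod_cast hξ'
  rw [← smul_sub, smul_smul, smul_smul]
  congr 1
  push_cast
  field_simp

/-- **RESCALING TO THE STEP CURRENCY OF [III] (2.38)**: the clause at the cube's own unit `η_n` and threshold `t` gives, for every `j ≥ n`, a gauge `u` (`G`-valued in r11's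
`suModel`) and a potential `A_j := L^{j−n}·A` with `U^u = e^{iη_jA_j}`, `Lⁿη_j‖A_j‖ < t`, `(Lⁿη_j)²‖∇^{η_j}A_j‖ < t` on the region of `Y` — the letters of `CondII238.localGauge`
at layer `n` of a step-`j` frame (`ξ = η_j`). [cite: Balaban1988Convergent, (2.38) p.261; Balaban1985Variational, Thm 1 (9) p.279] -/
theorem Sect2.LocalGaugeOn.rescale {Y : Set (Site P 0)} {n j : ℕ} (hn : n ≤ j) {t : ℝ} {U : GaugeField P 0 (SU N)} (h : Sect2.LocalGaugeOn Y (P.eta n) t U) :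
    ∃ u : Site P 0 → (MatA N)ˣ, (∀ x, u x ∈ (B12RegularSpaces111SpecialUnitary.suModel N).G) ∧ ∃ A : PBond P 0 → MatA N,
      (∀ b ∈ (Sect2.regionOfSet P Y).bonds, gaugeU u (fun b' => ιSU N (U b')) b = expI (P.eta j) (A b)) ∧
      (∀ b ∈ (Sect2.regionOfSet P Y).bonds, (P.L : ℝ) ^ n * P.eta j * ‖A b‖ < t) ∧
      ∀ q ∈ (Sect2.regionOfSet P Y).dpairs, ((P.L : ℝ) ^ n * P.eta j) ^ 2 * ‖grad (P.eta j) q.2.1 (fun y => A ⟨y, q.2.2⟩) q.1‖ < t := by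
  obtain ⟨u, A, he, hA, hdA⟩ := h
  set c : ℝ := (P.L : ℝ) ^ (j - n) with hc
  have hc0 : 0 ≤ c := pow_nonneg (Nat.cast_nonneg _) _
  have hηn : P.eta n ≠ 0 := (pow_pos (inv_pos.mpr (Nat.cast_pos.mpr P.L_pos)) n).ne'
  have hηj : 0 < P.eta j := pow_pos (inv_pos.mpr (Nat.cast_pos.mpr P.L_pos)) j
  have hunit : (P.L : ℝ) ^ n * P.eta j * c = 1 := L_pow_mul_eta_mul_L_pow hn
  refine ⟨fun x => ιSU N (u x), fun x => ιSU_mem_G N _, fun b => (c : ℂ) • A b, fun b hb => ?_, fun b hb => ?_, fun q hq => ?_⟩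
  · rw [he b hb, expI_smul_real, eta_mul_L_pow hn]
  · rw [norm_smul, Complex.norm_real, Real.norm_of_nonneg hc0, ← mul_assoc, hunit, one_mul]
    exact hA b hb
  · have hg := grad_smul_const (𝔸 := MatA N) (ξ := P.eta j) hηn c q.2.1 (fun y => A ⟨y, q.2.2⟩) q.1
    have hηn0 : 0 < P.eta n := pow_pos (inv_pos.mpr (Nat.cast_pos.mpr P.L_pos)) n
    have hκ : 0 ≤ (P.eta j)⁻¹ * c * P.eta n := by positivity
    have hκ1 : ((P.L : ℝ) ^ n * P.eta j) ^ 2 * ((P.eta j)⁻¹ * c * P.eta n) = 1 := by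
      have h1 : (P.L : ℝ) ^ n * P.eta n = 1 := L_pow_mul_eta n
      calc ((P.L : ℝ) ^ n * P.eta j) ^ 2 * ((P.eta j)⁻¹ * c * P.eta n)
          = ((P.L : ℝ) ^ n * P.eta j * c) * ((P.L : ℝ) ^ n * P.eta n) * (P.eta j * (P.eta j)⁻¹) := by ring
        _ = 1 := by rw [hunit, h1, mul_inv_cancel₀ hηj.ne', one_mul, one_mul]
    rw [hg, norm_smul, Complex.norm_real, Real.norm_of_nonneg hκ, ← mul_assoc, hκ1, one_mul]
    exact hdA q hq

/-- **[I] (1.12) ON THE CUBES OF RECORD `cubesI M j Y` FROM HANDED-OVER GAUGES** (FILE 4's `localGauge_cubesI_of_classBound` OUTPUT TYPE, no axial gauge, no chart, no wrapping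
letter): if every `L^{j+1}M`-cube meeting `Y` lies in `Ω` (FILE 5's `hcubeΩ_of_compatible` at the record) and every such cube lying in `Ω` carries the clause at unit `η_j` and
threshold `t ≤ O(1)LMB·α₀`, then r11's (1.12) clause holds on every `□ ∩ Y`. [cite: Balaban1987RG1, (1.12) p.262; Balaban1988Convergent, (2.27) p.259; Balaban1985Variational, Thm 1 (9) p.279] -/
theorem localGauge_cubesI_of_localGaugeOn {M j : ℕ} {Y Ω : Set (Site P 0)}
    (hcubeΩ : ∀ a ∈ cubeIndices P (B14.Eq213MaximalDomains.side P.L M (j + 1)),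
      (cubeEnl P (B14.Eq213MaximalDomains.side P.L M (j + 1)) a 0 ∩ Y).Nonempty → cubeEnl P (B14.Eq213MaximalDomains.side P.L M (j + 1)) a 0 ⊆ Ω)
    {U : GaugeField P 0 (SU N)} {t cB α₀ : ℝ} (ht : t ≤ cB * α₀)
    (hg : ∀ a ∈ cubeIndices P (B14.Eq213MaximalDomains.side P.L M (j + 1)), cubeEnl P (B14.Eq213MaximalDomains.side P.L M (j + 1)) a 0 ⊆ Ω →
      Sect2.LocalGaugeOn (cubeEnl P (B14.Eq213MaximalDomains.side P.L M (j + 1)) a 0) (P.eta j) t U) :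
    ∀ C ∈ Sect2.cubesI M j Y, ∃ u : Site P 0 → (MatA N)ˣ, (∀ x, u x ∈ (B12RegularSpaces111SpecialUnitary.suModel N).G) ∧ ∃ A : PBond P 0 → MatA N,
      (∀ bd ∈ C.bonds, gaugeU u (fun b' => ιSU N (U b')) bd = expI (P.eta j) (A bd)) ∧ (∀ bd ∈ C.bonds, ‖A bd‖ < cB * α₀) ∧
      ∀ q ∈ C.dpairs, ‖grad (P.eta j) q.2.1 (fun y => A ⟨y, q.2.2⟩) q.1‖ < cB * α₀ := by
  rintro C ⟨a, ha, hne, rfl⟩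
  obtain ⟨u, A, he, hA, hdA⟩ := ((hg a ha (hcubeΩ a ha hne)).anti Set.inter_subset_left).of_le ht
  exact ⟨fun x => ιSU N (u x), fun x => ιSU_mem_G N _, A, he, hA, hdA⟩

/-- **[III] (2.38) ON THE LAYER CUBES OF RECORD `cubesMS M j Y Ω n` FROM HANDED-OVER GAUGES** (FILE 4's `condII238_cubesMS_of_classBounds` OUTPUT TYPE): if at every layer
`1 ≤ n ≤ j` every `LⁿM`-cube meeting `Y` and lying in `Ω_n` carries the clause at its own unit `η_n` and threshold `t_n ≤ BCM·α_{0,n}`, then r11's `CondII238` holds for `ι ∘ U` on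
the multi-scale frame of record at step `j` (rescaling §0). [cite: Balaban1988Convergent, (2.38) p.261, (2.28) p.259; Balaban1985Variational, Thm 1 (9) p.279] -/
theorem condII238_cubesMS_of_localGaugeOn {M j : ℕ} {Y : Set (Site P 0)} {Ω : ℕ → Set (Site P 0)} {U : GaugeField P 0 (SU N)} {t : ℕ → ℝ}
    {βc B C Mr : ℝ} {α₀ : ℕ → ℝ} (ht : ∀ n, 1 ≤ n → n ≤ j → t n ≤ rad238 B C Mr (α₀ n))
    (hg : ∀ n, 1 ≤ n → n ≤ j → ∀ a ∈ cubeIndices P (B14.Eq213MaximalDomains.side P.L M n),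
      (cubeEnl P (B14.Eq213MaximalDomains.side P.L M n) a 0 ∩ Y).Nonempty → cubeEnl P (B14.Eq213MaximalDomains.side P.L M n) a 0 ⊆ Ω n →
      Sect2.LocalGaugeOn (cubeEnl P (B14.Eq213MaximalDomains.side P.L M n) a 0) (P.eta n) (t n) U) :
    CondII238 (B12RegularSpaces111SpecialUnitary.suModel N) (Sect2.frameMS (Sect2.Residual.unit P (MatA N)) M j Y Ω) (MSConsts.ofParams P βc B C Mr j) α₀
      (fun b' => ιSU N (U b')) := by
  refine ⟨fun n h1 hn C hC => ?_⟩
  obtain ⟨a, ha, hne, hgeo, rfl⟩ := hC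
  have hcubeΩ : cubeEnl P (B14.Eq213MaximalDomains.side P.L M n) a 0 ⊆ Ω n := by
    rcases hgeo with ⟨_, hsub, _⟩ | ⟨rfl, hsub⟩
    · exact fun x hx => (hsub hx).1
    · exact hsub
  obtain ⟨u, hG, A, he, hA, hdA⟩ := (((hg n h1 hn a ha hne hcubeΩ).anti Set.inter_subset_left).of_le (ht n h1 hn)).rescale hn
  exact ⟨u, hG, A, he, hA, hdA⟩

end GaugeClause

/-! ## §1  The gauge sentence of [15] Theorem 1 — (9) line 1 in ∃-gauge form — over the top-domain class (6), guarded edition (`M₁ ≥ 1`), cube letter `M` a parameter -/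

section NamedFactGaugeTopM

variable (F : T4Family) (N : ℕ) [NeZero N]

/-- **★★ NAMED FACT — [15] THEOREM 1 (9) LINE 1, ∃-GAUGE FORM, OVER PRINT'S CLASS (6) OF CONFIGURATIONS ON THE SUPPORT `Ω₀ = Sup ν K s.Ω`, THRESHOLDS COMPARABLE BOTH WAYS,
AT NUMERICS WITH `M₁ ≥ 1`, CUBE LETTER `M`** (a `Prop` with parameters, NEVER asserted): FILE 12d's `VariationalThm1RegSepTop7M F N Sup B₃ a₀ a₁` binder block byte for byte
with the cube letter `M` of `s : SeqOfRecord F ν M g K k` moved to the parameters — separated `s`, `0 < ν.M₁`, `0 < δ_n ≤ a₁`, `B₃δ_n ≤ ε₀ ≤ a₀` (print's standing range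
«ε₁ ≤ a₁, B₃ε₁ ≤ ε₀ ≤ a₀» with the (8)∕uniqueness constant `B₃`), `δ_n ≤ 2δ_{n+1}` and `δ_{n+1} ≤ 2δ_n`, datum with (7) on the support (`Sect2.DataSmall7PTop`), EVERY
minimiser `U₀` over the top-domain class (6) at `ε₀` — with the conclusion: at every scale `1 ≤ n ≤ k`, every `LⁿM`-cube of the fine torus lying in `Ω_n` (the [III] (2.38)
cubes, `side L M n` fine sites) AND every `L^{n+1}M`-cube lying in `Ω_n` (the [I] (1.12) cubes, `side L M (n+1)`), each family under print's NON-WRAPPING letter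
`(side : ℤ) < sitesPerDir 0` (the cubes of `T_η` never wrap the torus; FILE 12a's `hsN`; dag-n07-e FILED-23 (Δ2)), carries `Sect2.LocalGaugeOn □ η_n (B₃'·δ_n) U₀`: an
`SU(N)`-valued gauge `u` and a potential `A` with `U₀^u = e^{iη_nA}`, `‖A‖ < B₃'δ_n`, `‖∇^{η_n}A‖ < B₃'δ_n` on `□` — print's (9) line 1 «U^u = e^{iηA}, |A| < B₃Mε₁(L^jη)⁻¹,
|∇^ηA| < B₃Mε₁(L^jη)⁻²» in the units `L^jη = 1` of the cube's own scale (print's `j` = our `n`, `ε₁ ↦ δ_n`).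
HONEST LABEL: verbatim (9) line 1 modulo units, the NAMED ABSORPTIONS into `B₃'` of `B₃·M` (MS cubes) resp. `B₃·LM` (I cubes) (print: `M` a multiple of `R₁M₁`,
`M ≤ M(ε₁) = R₁M₁(a₁∕ε₁)`) and of the one-scale factor `≤ 2L³` for cubes in the collar of `Ω_n` covered only by scale-`(n−1)` class cubes (print's class cubes of scale `n` have
their `2R₁M₁Lⁿη`-enlargement inside `Ω_n ∖ Ω_{n+2}`; two-sided comparability `δ_{n−1} ≤ 2δ_n`) — so `B₃'` depends on `d, L, M` —, and [III]'s reading (2.27)–(2.28) p. 259 that the depth-`k` background carries ONE such gauge on every cube of these two families inside `Ω_n`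
(including top-layer cubes of a step frame meeting finer domains; deeper class cubes have smaller absolute thresholds by two-sided comparability).  NO Hölder member of (9), NO (10),
NO curvature derivative (LOCATED-M6: those do not give a sup bound on `∇∇A`, [6] p. 83).  Expected inhabitation floor: `0 < B₃'`; companion (8)-sentence floor `2L² ≤ B₃`.
-- TODO(general form): print states (9) on the class cubes of pp. 278–279 with the Hölder member `B₄(β₀)` and (10) for `∂^{η*}∂^ηA`, `Δ^ηA`, ONE threshold ε₁, general
-- admissible `{Ω_j}`∕`𝔅_k` ([6] Sect. A), print's separation letter `R ≥ R₁`; orbit uniqueness is not part of this sentence.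
[cite: Balaban1985Variational, (1) p.277, Thm 1 (2),(3),(5),(6),(7),(9) pp.278–279, (152) p.301, (167) p.304, (169) p.305; Balaban1985RegularSpaces, (1.3)–(1.9) p.77, (1.36) p.83; Balaban1988Convergent, p.255, (2.6)–(2.8) pp.255–256, (2.12) p.256, (2.27)–(2.28) p.259, (2.38) p.261; Balaban1987RG1, (1.12) p.262] -/
def VariationalThm1GaugeRegSepTop7M (Sup : (ν : Stage7Numerics) → (K : ℕ) → (ℕ → Set (Site (F.P K) 0)) → Set (Site (F.P K) 0)) (M : ℕ) (B₃ B₃' a₀ a₁ : ℝ) : Prop :=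
  ∀ (ν : Stage7Numerics) (g : ℕ → ℝ) (K k : ℕ) (s : SeqOfRecord F ν M g K k), Sect2.SeqSeparated ν.M₁ s → 0 < ν.M₁ → ∀ (ε₀ : ℝ) (δ : ℕ → ℝ),
    (∀ n, n ≤ k → 0 < δ n ∧ δ n ≤ a₁ ∧ B₃ * δ n ≤ ε₀) → (∀ n, n < k → δ n ≤ 2 * δ (n + 1)) → (∀ n, n < k → δ (n + 1) ≤ 2 * δ n) → ε₀ ≤ a₀ →
    ∀ W : MSField (F.P K) (SU N), Sect2.DataSmall7PTop (avOfRecord F N K) s.Ω (Sup ν K s.Ω) k δ W →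
      ∀ U₀, IsMinimizer (avOfRecord F N K)
          {U | (∀ n, n ≤ k → PlaqSmallOn (Sect2.omegaPlaqsTop s.Ω (Sup ν K s.Ω) n) (ε₀ * (F.P K).eta n ^ 2) U) ∧
            Sect2.CoDivClassOnTop s.Ω (Sup ν K s.Ω) k ε₀ U} (genSet s.Ω k) W U₀ →
        ∀ n, 1 ≤ n → n ≤ k →
          (((B14.Eq213MaximalDomains.side (F.P K).L M n : ℕ) : ℤ) < (F.P K).sitesPerDir 0 →
            ∀ a ∈ cubeIndices (F.P K) (B14.Eq213MaximalDomains.side (F.P K).L M n),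
              cubeEnl (F.P K) (B14.Eq213MaximalDomains.side (F.P K).L M n) a 0 ⊆ s.Ω n →
              Sect2.LocalGaugeOn (cubeEnl (F.P K) (B14.Eq213MaximalDomains.side (F.P K).L M n) a 0) ((F.P K).eta n) (B₃' * δ n) U₀) ∧
          (((B14.Eq213MaximalDomains.side (F.P K).L M (n + 1) : ℕ) : ℤ) < (F.P K).sitesPerDir 0 →
            ∀ a ∈ cubeIndices (F.P K) (B14.Eq213MaximalDomains.side (F.P K).L M (n + 1)),
              cubeEnl (F.P K) (B14.Eq213MaximalDomains.side (F.P K).L M (n + 1)) a 0 ⊆ s.Ω n →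
              Sect2.LocalGaugeOn (cubeEnl (F.P K) (B14.Eq213MaximalDomains.side (F.P K).L M (n + 1)) a 0) ((F.P K).eta n) (B₃' * δ n) U₀)

variable {F N}

/-- The gauge top-domain sentence is ANTITONE in `a₀`, `a₁`. [cite: Balaban1985Variational, Thm 1 p.279 (the range «ε₀ ≤ a₀», «ε₁ ≤ a₁»)] -/
theorem VariationalThm1GaugeRegSepTop7M.of_le {Sup : (ν : Stage7Numerics) → (K : ℕ) → (ℕ → Set (Site (F.P K) 0)) → Set (Site (F.P K) 0)} {M : ℕ} {B₃ B₃' a₀ a₀' a₁ a₁' : ℝ}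
    (h : VariationalThm1GaugeRegSepTop7M F N Sup M B₃ B₃' a₀ a₁) (ha₀ : a₀' ≤ a₀) (ha₁ : a₁' ≤ a₁) : VariationalThm1GaugeRegSepTop7M F N Sup M B₃ B₃' a₀' a₁' :=
  fun ν g K k s hsep hM₁ ε₀ δ hnum hcomp hcomp' hε W h7 U₀ hmin =>
    h ν g K k s hsep hM₁ ε₀ δ (fun n hn => ⟨(hnum n hn).1, (hnum n hn).2.1.trans ha₁, (hnum n hn).2.2⟩) hcomp hcomp' (hε.trans ha₀) W h7 U₀ hmin

/-- The gauge top-domain sentence is MONOTONE in the gauge constant `B₃'` (a larger constant is a weaker conclusion). [cite: Balaban1985Variational, Thm 1 (9) p.279 (bookkeeping)] -/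
theorem VariationalThm1GaugeRegSepTop7M.mono {Sup : (ν : Stage7Numerics) → (K : ℕ) → (ℕ → Set (Site (F.P K) 0)) → Set (Site (F.P K) 0)} {M : ℕ} {B₃ B₃' B₃'' a₀ a₁ : ℝ}
    (h : VariationalThm1GaugeRegSepTop7M F N Sup M B₃ B₃' a₀ a₁) (hB : B₃' ≤ B₃'') : VariationalThm1GaugeRegSepTop7M F N Sup M B₃ B₃'' a₀ a₁ := by
  intro ν g K k s hsep hM₁ ε₀ δ hnum hcomp hcomp' hε W h7 U₀ hmin n hn1 hnk
  have hδ : B₃' * δ n ≤ B₃'' * δ n := mul_le_mul_of_nonneg_right hB (hnum n hnk).1.le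
  obtain ⟨hMS, hI⟩ := h ν g K k s hsep hM₁ ε₀ δ hnum hcomp hcomp' hε W h7 U₀ hmin n hn1 hnk
  exact ⟨fun hsN a ha hΩ => (hMS hsN a ha hΩ).of_le hδ, fun hsN a ha hΩ => (hI hsN a ha hΩ).of_le hδ⟩

end NamedFactGaugeTopM

/-! ## §2  ROW P11's body keyed on HANDED-OVER GAUGES (no axial potential), and the supplier from the two cited sentences over the top-domain class -/

section RowBodyGauge

variable {F : T4Family} {N : ℕ} [NeZero N]

/-- **★★ THE ROW'S BODY FOR AN ARBITRARY BACKGROUND `U` FROM PER-SCALE CLASS BOUNDS AT THE SCALES `1 ≤ n ≤ k` AND HANDED-OVER LOCAL GAUGES** — FILE 12a's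
`bgRowAtDatumU_of_classBoundsPos` with the axial-potential derivative members `h3I`∕`h3MS` and the axial letters (`hsN`, `hcB`, `hBCM`, `hsmallI`, `hsmallMS`, `hb0`) REPLACED by:
the two gauge families `hgMS` (every `LⁿM`-cube inside `Ω_n`: `Sect2.LocalGaugeOn □ η_n (t n) U`) and `hgI` (every `L^{n+1}M`-cube inside `Ω_n`, same), and the two radius letters
`t_n ≤ O(1)LMB·α₀(g_n)` ((1.12)) and `t_n ≤ BCM·α₀(g_n)` ((2.38)).  The plaquette clauses (1.11)∕(2.34) still come from the class bounds `b_n·η_n²` with `b_n ≤ (1 − β)α₀(g_n)`; the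
(1.12) cubes meeting `X ⊆ Λ_j` lie in `Ω_j` by the compatibility (C1)(C2) (FILE 5's `hcubeΩ_of_compatible`); the (2.38) cubes lie in `Ω_n` by definition of the frame.
[cite: Balaban1988Convergent, (2.27)–(2.28) p.259, (2.34)–(2.41) p.261; Balaban1987RG1, (1.11)–(1.16) p.262; Balaban1985Variational, Thm 1 (9) p.279] -/
theorem bgRowAtDatumU_of_classBoundsPos_of_localGauge (S : Sect2.Setting (MatA N) (SU N)) (hι : S.ι = ιSU N) (h𝓜 : S.𝓜 = B12RegularSpaces111SpecialUnitary.suModel N)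
    (hS : S.Laws) (hpos : S.Pos) (ν : Stage7Numerics) {M : ℕ} (hM : 0 < M) (K k : ℕ) {b t : ℕ → ℝ}
    (s : SeqOfRecord F ν M S.flow.g K k) (U : GaugeField (F.P K) 0 (SU N))
    (hclass : ∀ n, 1 ≤ n → n ≤ k → PlaqSmallOn (omegaPlaqs s.Ω n) (b n * (F.P K).eta n ^ 2) (U))
    (hα : ∀ n, 1 ≤ n → n ≤ k → 0 < S.lf.alpha0 (S.flow.g n) ∧ 0 < S.lf.alpha1 (S.flow.g n))
    (hbα : ∀ n, 1 ≤ n → n ≤ k → b n ≤ (1 - S.βc) * S.lf.alpha0 (S.flow.g n))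
    (htI : ∀ n, 1 ≤ n → n ≤ k → t n ≤ S.cB * S.lf.alpha0 (S.flow.g n))
    (htMS : ∀ n, 1 ≤ n → n ≤ k → t n ≤ S.B * S.C * S.Mr * S.lf.alpha0 (S.flow.g n))
    (hC1 : ∀ j, 1 ≤ j → j ≤ k → ∃ t : ℕ, 0 < t ∧ RkOfRecord (F.P K).L ν.r (S.flow.g j) = (F.P K).L * t)
    (hC2 : ∀ j, 1 ≤ j → j ≤ k → dCubeSide (F.P K).L M (RkOfRecord (F.P K).L ν.r (S.flow.g j)) j ∣ (F.P K).sitesPerDir 0)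
    (hgMS : ∀ n, 1 ≤ n → n ≤ k → ∀ a ∈ cubeIndices (F.P K) (B14.Eq213MaximalDomains.side (F.P K).L M n),
      cubeEnl (F.P K) (B14.Eq213MaximalDomains.side (F.P K).L M n) a 0 ⊆ s.Ω n →
      Sect2.LocalGaugeOn (cubeEnl (F.P K) (B14.Eq213MaximalDomains.side (F.P K).L M n) a 0) ((F.P K).eta n) (t n) U)
    (hgI : ∀ n, 1 ≤ n → n ≤ k → ∀ a ∈ cubeIndices (F.P K) (B14.Eq213MaximalDomains.side (F.P K).L M (n + 1)),
      cubeEnl (F.P K) (B14.Eq213MaximalDomains.side (F.P K).L M (n + 1)) a 0 ⊆ s.Ω n →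
      Sect2.LocalGaugeOn (cubeEnl (F.P K) (B14.Eq213MaximalDomains.side (F.P K).L M (n + 1)) a 0) ((F.P K).eta n) (t n) U) :
    ∀ j, 1 ≤ j → j ≤ k → ∀ X : (Sect2.domSys (F.P K) M j).Dom,
      (Sect2.domSites (F.P K) M j X ⊆ s.Λ j →
        Sect2.ofBackgroundC S.ι (U) ∈
          Sect2.spaceI S (Sect2.Residual.unit (F.P K) (MatA N)) M j (Sect2.domSites (F.P K) M j X) (S.lf.alpha0 (S.flow.g j)) (S.lf.alpha1 (S.flow.g j))) ∧
      (Sect2.admB (F.P K) ν M S.flow.g s.Ω s.Λ j (Sect2.domSites (F.P K) M j X) = true →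
        Sect2.ofBackgroundC S.ι (U) ∈
          Sect2.spaceMS S (Sect2.Residual.unit (F.P K) (MatA N)) M j (Sect2.domSites (F.P K) M j X) s.Ω) := by
  intro j h1 hjk X
  have hbα' : ∀ n, 1 ≤ n → n ≤ k → b n ≤ S.lf.alpha0 (S.flow.g n) := by
    intro n hn1 hnk
    refine (hbα n hn1 hnk).trans ?_
    have h0 := (hα n hn1 hnk).1.le
    nlinarith [hpos.βc_nonneg, h0]
  refine ⟨fun hX => ?_, fun _ => ?_⟩
  · -- the `U^c_j` conjunct: class bound at scale `j` for (1.11), the handed-over gauges on the (1.12) cubes (in `Ω_j` by compatibility)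
    have hcubeΩ := hcubeΩ_of_compatible (F := F) ν hM S.flow.g K k s hC1 hC2 j h1 hjk X hX
    have hloc : ∀ C ∈ Sect2.cubesI M j (Sect2.domSites (F.P K) M j X), ∃ u : Site (F.P K) 0 → (MatA N)ˣ, (∀ x, u x ∈ S.𝓜.G) ∧ ∃ A : PBond (F.P K) 0 → MatA N,
          (∀ bd ∈ C.bonds, gaugeU u (fun b' => S.ι (U b')) bd = expI ((F.P K).eta j) (A bd)) ∧
          (∀ bd ∈ C.bonds, ‖A bd‖ < S.cB * S.lf.alpha0 (S.flow.g j)) ∧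
          ∀ q ∈ C.dpairs, ‖grad ((F.P K).eta j) q.2.1 (fun y => A ⟨y, q.2.2⟩) q.1‖ < S.cB * S.lf.alpha0 (S.flow.g j) := by
      simp only [hι, h𝓜]
      exact localGauge_cubesI_of_localGaugeOn hcubeΩ (htI j h1 hjk) (hgI j h1 hjk)
    exact ofBackgroundC_mem_spaceI_of_classBoundU S hι hS ν M S.flow.g K k s U h1 hjk (hα j h1 hjk).1 (hα j h1 hjk).2 X hX
      (hbα' j h1 hjk) (hclass j h1 hjk) hloc
  · -- the `Ũ^c_j` conjunct: class bounds at the scales `1 ≤ n ≤ j` for (2.34), the handed-over gauges on the (2.38) cubes, rescaled to `ξ = η_j`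
    have h238 : CondII238 S.𝓜 (Sect2.frameMS (Sect2.Residual.unit (F.P K) (MatA N)) M j (Sect2.domSites (F.P K) M j X) s.Ω)
          (MSConsts.ofParams (F.P K) S.βc S.B S.C S.Mr j) (fun n => S.lf.alpha0 (S.flow.g n)) (fun b' => S.ι (U b')) := by
      simp only [hι, h𝓜]
      refine condII238_cubesMS_of_localGaugeOn (fun n hn1 hnj => ?_) (fun n hn1 hnj a ha _ hΩ => hgMS n hn1 (hnj.trans hjk) a ha hΩ)
      unfold rad238
      exact htMS n hn1 (hnj.trans hjk)
    exact ofBackgroundC_mem_spaceMS_of_classBoundU S hι hS hpos ν M K k s U (fun n hn1 hnj => hα n hn1 (hnj.trans hjk)) X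
      (fun n hn1 hnj => hbα n hn1 (hnj.trans hjk)) (fun n hn1 hnj => hclass n hn1 (hnj.trans hjk)) h238

/-- **★ EVERY MINIMISER OVER THE TOP-DOMAIN CLASS (6) AT THE RECORD'S LETTERS CARRIES THE LOCAL GAUGES OF (9) LINE 1 AT THRESHOLD `B₃'·cR·ε_n` ON BOTH CUBE FAMILIES INSIDE `Ω_n`,
`1 ≤ n ≤ k`**, for a separated sequence, numerics with `M₁ ≥ 1`, thresholds comparable both ways and a datum with print's (7) on the support, from the gauge sentence; `εreg` generic.
[cite: Balaban1985Variational, Thm 1 (2),(6),(7),(9) pp.278–279; Balaban1985RegularSpaces, (1.3) p.77; Balaban1988Convergent, (2.6)–(2.8) pp.255–256, (2.12) p.256, (2.38) p.261] -/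
theorem localGaugeOn_of_thm1GaugeRegSepTop7M {Sup : (ν : Stage7Numerics) → (K : ℕ) → (ℕ → Set (Site (F.P K) 0)) → Set (Site (F.P K) 0)} {M : ℕ} {B₃ B₃' a₀ a₁ : ℝ}
    (h15G : VariationalThm1GaugeRegSepTop7M F N Sup M B₃ B₃' a₀ a₁) (ν : Stage7Numerics)
    (g : ℕ → ℝ) (K k : ℕ) (cR : ℝ) (s : SeqOfRecord F ν M g K k) (hsep : Sect2.SeqSeparated ν.M₁ s) (hM₁ : 0 < ν.M₁)
    (hnum : ∀ n, n ≤ k → 0 < cR * epsOfRecord ν g n ∧ cR * epsOfRecord ν g n ≤ a₁ ∧ B₃ * (cR * epsOfRecord ν g n) ≤ ν.εreg) (ha₀ : ν.εreg ≤ a₀)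
    (hcomp : ∀ n, n < k → cR * epsOfRecord ν g n ≤ 2 * (cR * epsOfRecord ν g (n + 1)))
    (hcomp' : ∀ n, n < k → cR * epsOfRecord ν g (n + 1) ≤ 2 * (cR * epsOfRecord ν g n))
    {W : MSField (F.P K) (SU N)} (h7 : Sect2.DataSmall7PTop (avOfRecord F N K) s.Ω (Sup ν K s.Ω) k (fun n => cR * epsOfRecord ν g n) W)
    {U₀ : GaugeField (F.P K) 0 (SU N)} (hmin : IsMinimizer (avOfRecord F N K)
      {U | (∀ n, n ≤ k → PlaqSmallOn (Sect2.omegaPlaqsTop s.Ω (Sup ν K s.Ω) n) (ν.εreg * (F.P K).eta n ^ 2) U) ∧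
        Sect2.CoDivClassOnTop s.Ω (Sup ν K s.Ω) k ν.εreg U} (genSet s.Ω k) W U₀) :
    ∀ n, 1 ≤ n → n ≤ k →
      (((B14.Eq213MaximalDomains.side (F.P K).L M n : ℕ) : ℤ) < (F.P K).sitesPerDir 0 →
        ∀ a ∈ cubeIndices (F.P K) (B14.Eq213MaximalDomains.side (F.P K).L M n),
          cubeEnl (F.P K) (B14.Eq213MaximalDomains.side (F.P K).L M n) a 0 ⊆ s.Ω n →
          Sect2.LocalGaugeOn (cubeEnl (F.P K) (B14.Eq213MaximalDomains.side (F.P K).L M n) a 0) ((F.P K).eta n) (B₃' * (cR * epsOfRecord ν g n)) U₀) ∧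
      (((B14.Eq213MaximalDomains.side (F.P K).L M (n + 1) : ℕ) : ℤ) < (F.P K).sitesPerDir 0 →
        ∀ a ∈ cubeIndices (F.P K) (B14.Eq213MaximalDomains.side (F.P K).L M (n + 1)),
          cubeEnl (F.P K) (B14.Eq213MaximalDomains.side (F.P K).L M (n + 1)) a 0 ⊆ s.Ω n →
          Sect2.LocalGaugeOn (cubeEnl (F.P K) (B14.Eq213MaximalDomains.side (F.P K).L M (n + 1)) a 0) ((F.P K).eta n) (B₃' * (cR * epsOfRecord ν g n)) U₀) :=
  h15G ν g K k s hsep hM₁ ν.εreg (fun n => cR * epsOfRecord ν g n) hnum hcomp hcomp' ha₀ W h7 U₀ hmin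

/-- **★★★ ROW P11's BODY AT `(s, 𝐖)` FOR EVERY MINIMISER `U₀` OVER THE TOP-DOMAIN CLASS (6), FROM THE TWO CITED [15] SENTENCES — (8) (`VariationalThm1RegSepTop7M`, FILE 12d) AND (9)
LINE 1 (`VariationalThm1GaugeRegSepTop7M`, §1) — PLUS PROVED GLUE**: the plaquette class bounds at the scales `1 ≤ n ≤ k` from (8), the (1.12)∕(2.38) local gauges from (9) line 1
(handed over, rescaled to the step currency in §0), print's (7) on the datum over the support (`h7`), the numerics `hnum`∕`ha₀`∕`hBα`, two-sided comparability, `hM₁`, (C1)(C2), and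
the two radius letters `B₃'·cR·ε_n ≤ O(1)LMB·α₀(g_n)`, `B₃'·cR·ε_n ≤ BCM·α₀(g_n)` (print's «B sufficiently large», [I] p. 262; [III] (2.38) «with an absolute constant B»), and the
non-wrapping letter `hsN` of FILE 12a (the cubes of record do not wrap the torus).  NO C¹ clause, NO axial potential, NO FILE 7c letters.  def-R′ instantiates `Sup := suppDomOfRecord`,
`U₀ := UbgMSCoPOfRecord … s W` (§3).
[cite: Balaban1985Variational, Thm 1 (2),(6)–(9) pp.278–279; Balaban1985RegularSpaces, (1.3)–(1.9) p.77; Balaban1988Convergent, (2.4)–(2.8) pp.255–256, (2.12) p.256, (2.27)–(2.28) p.259, (2.34)–(2.41) p.261; Balaban1987RG1, (1.11)–(1.16) p.262] -/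
theorem bgRowAtDatumU_of_thm1RegSepTop7M_of_thm1Gauge {Sup : (ν : Stage7Numerics) → (K : ℕ) → (ℕ → Set (Site (F.P K) 0)) → Set (Site (F.P K) 0)} {M : ℕ}
    {B₃ B₃' a₀ a₁ : ℝ} (h15 : VariationalThm1RegSepTop7M F N Sup B₃ a₀ a₁) (h15G : VariationalThm1GaugeRegSepTop7M F N Sup M B₃ B₃' a₀ a₁)
    (S : Sect2.Setting (MatA N) (SU N)) (hι : S.ι = ιSU N) (h𝓜 : S.𝓜 = B12RegularSpaces111SpecialUnitary.suModel N) (hS : S.Laws) (hpos : S.Pos)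
    (ν : Stage7Numerics) (hM : 0 < M) (K k : ℕ) (cR : ℝ)
    (hnum : ∀ n, n ≤ k → 0 < cR * epsOfRecord ν S.flow.g n ∧ cR * epsOfRecord ν S.flow.g n ≤ a₁ ∧ B₃ * (cR * epsOfRecord ν S.flow.g n) ≤ ν.εreg)
    (ha₀ : ν.εreg ≤ a₀) (hcomp : ∀ n, n < k → cR * epsOfRecord ν S.flow.g n ≤ 2 * (cR * epsOfRecord ν S.flow.g (n + 1)))
    (hcomp' : ∀ n, n < k → cR * epsOfRecord ν S.flow.g (n + 1) ≤ 2 * (cR * epsOfRecord ν S.flow.g n))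
    (hα : ∀ n, 1 ≤ n → n ≤ k → 0 < S.lf.alpha0 (S.flow.g n) ∧ 0 < S.lf.alpha1 (S.flow.g n))
    (hBα : ∀ n, 1 ≤ n → n ≤ k → B₃ * (cR * epsOfRecord ν S.flow.g n) ≤ (1 - S.βc) * S.lf.alpha0 (S.flow.g n))
    (htI : ∀ n, 1 ≤ n → n ≤ k → B₃' * (cR * epsOfRecord ν S.flow.g n) ≤ S.cB * S.lf.alpha0 (S.flow.g n))
    (htMS : ∀ n, 1 ≤ n → n ≤ k → B₃' * (cR * epsOfRecord ν S.flow.g n) ≤ S.B * S.C * S.Mr * S.lf.alpha0 (S.flow.g n))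
    (hC1 : ∀ j, 1 ≤ j → j ≤ k → ∃ t : ℕ, 0 < t ∧ RkOfRecord (F.P K).L ν.r (S.flow.g j) = (F.P K).L * t)
    (hC2 : ∀ j, 1 ≤ j → j ≤ k → dCubeSide (F.P K).L M (RkOfRecord (F.P K).L ν.r (S.flow.g j)) j ∣ (F.P K).sitesPerDir 0)
    (hsN : ∀ n, 1 ≤ n → n ≤ k + 1 → ((B14.Eq213MaximalDomains.side (F.P K).L M n : ℕ) : ℤ) < (F.P K).sitesPerDir 0)
    (s : SeqOfRecord F ν M S.flow.g K k) (hsep : Sect2.SeqSeparated ν.M₁ s) (hM₁ : 0 < ν.M₁) {W : MSField (F.P K) (SU N)}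
    (h7 : Sect2.DataSmall7PTop (avOfRecord F N K) s.Ω (Sup ν K s.Ω) k (fun n => cR * epsOfRecord ν S.flow.g n) W)
    {U₀ : GaugeField (F.P K) 0 (SU N)} (hmin : IsMinimizer (avOfRecord F N K)
      {U | (∀ n, n ≤ k → PlaqSmallOn (Sect2.omegaPlaqsTop s.Ω (Sup ν K s.Ω) n) (ν.εreg * (F.P K).eta n ^ 2) U) ∧
        Sect2.CoDivClassOnTop s.Ω (Sup ν K s.Ω) k ν.εreg U} (genSet s.Ω k) W U₀) :
    ∀ j, 1 ≤ j → j ≤ k → ∀ X : (Sect2.domSys (F.P K) M j).Dom,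
      (Sect2.domSites (F.P K) M j X ⊆ s.Λ j →
        Sect2.ofBackgroundC S.ι (U₀) ∈
          Sect2.spaceI S (Sect2.Residual.unit (F.P K) (MatA N)) M j (Sect2.domSites (F.P K) M j X) (S.lf.alpha0 (S.flow.g j)) (S.lf.alpha1 (S.flow.g j))) ∧
      (Sect2.admB (F.P K) ν M S.flow.g s.Ω s.Λ j (Sect2.domSites (F.P K) M j X) = true →
        Sect2.ofBackgroundC S.ι (U₀) ∈
          Sect2.spaceMS S (Sect2.Residual.unit (F.P K) (MatA N)) M j (Sect2.domSites (F.P K) M j X) s.Ω) := by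
  have hplaq := plaqSmallOn_of_thm1RegSepTop7M h15 ν M S.flow.g K k cR s hsep hM₁ hnum ha₀ hcomp hcomp' h7 hmin
  have hclass : ∀ n, 1 ≤ n → n ≤ k → PlaqSmallOn (omegaPlaqs s.Ω n) (B₃ * (cR * epsOfRecord ν S.flow.g n) * (F.P K).eta n ^ 2) U₀ := by
    intro n hn1 hnk
    have := hplaq n hnk
    rwa [Sect2.omegaPlaqsTop_of_ne_zero _ _ (Nat.one_le_iff_ne_zero.mp hn1)] at this
  have hg := localGaugeOn_of_thm1GaugeRegSepTop7M h15G ν S.flow.g K k cR s hsep hM₁ hnum ha₀ hcomp hcomp' h7 hmin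
  exact bgRowAtDatumU_of_classBoundsPos_of_localGauge S hι h𝓜 hS hpos ν hM K k s U₀ hclass hα hBα htI htMS hC1 hC2
    (fun n hn1 hnk => (hg n hn1 hnk).1 (hsN n hn1 (by omega))) (fun n hn1 hnk => (hg n hn1 hnk).2 (hsN (n + 1) (by omega) (by omega)))

/-- **THE TWO RADIUS LETTERS FROM THE NUMERICS** («B sufficiently large» ∕ «C₀ sufficiently large», one line of FILE 2 §1): along the window `0 < g_n`, `g_n² ≤ e⁻¹`, with `p₀ ≤ q₀` and
`0 ≤ B₃'·cR·A₀ ≤ t·C₀`, the threshold `B₃'·cR·ε_n` is `≤ t·α₀(g_n)` at every scale `1 ≤ n ≤ k` (`t := O(1)LMB = cB` gives `htI`, `t := B·C·M` gives `htMS` of §2∕§3's ★★★).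
[cite: Balaban1988Convergent, (2.4) p.255, (2.28) p.259; Balaban1987RG1, (1.12) p.262] -/
theorem gaugeLetter_of_numerics (lf : Step.LFConsts) (ν : Stage7Numerics) {B₃' cR t : ℝ} {g : ℕ → ℝ} {k : ℕ}
    (hg : ∀ n, 1 ≤ n → n ≤ k → 0 < g n ∧ g n ^ 2 ≤ Real.exp (-1)) (hpq : ν.p₀ ≤ lf.q₀) (hBc : 0 ≤ B₃' * cR * ν.A₀) (hC : B₃' * cR * ν.A₀ ≤ t * lf.C₀) :
    ∀ n, 1 ≤ n → n ≤ k → B₃' * (cR * epsOfRecord ν g n) ≤ t * lf.alpha0 (g n) :=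
  fun n h1 hn => mul_eps_le_mul_alpha0 lf (hg n h1 hn).1.le (one_le_log_inv_sq (hg n h1 hn).1 (hg n h1 hn).2) hpq hBc hC

end RowBodyGauge

/-! ## §3  The gauge sentence AT THE SUPPORT OF RECORD and the suppliers at node00-def-R's `UbgMSCoPOfRecord … s 𝐖` — the v1.5∕v1.6 `bg` supplier on two cited sentences -/

section AtRecordGaugeCoPM

variable (F : T4Family) (N : ℕ) [NeZero N]

/-- **★★ NAMED FACT, `CoP` EDITION, GUARDED — [15] THEOREM 1 (9) LINE 1 IN ∃-GAUGE FORM OVER CLASS (6) ON THE SUPPORT OF RECORD `suppDomOfRecord`, `M₁ ≥ 1`, TWO-SIDED COMPARABILITY,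
CUBE LETTER `M`**: §1's `VariationalThm1GaugeRegSepTop7M` at the selector `Sup := suppDomOfRecord` (so its class literal is node00-def-R's `regMSCoPOfRecord F N ν K k s.Ω` with `ε₀` for
`εreg`, by `rfl`).  The citeable token of the v1.5∕v1.6 `bg` road's SECOND sentence; a `Prop` with parameters, NEVER asserted.  Expected inhabitation floor: `0 < B₃'`.
-- TODO(general form): as §1 (Hölder member and (10) not part of this sentence; ONE threshold ε₁ in print; general admissible `{Ω_j}`; separation letter `R ≥ R₁`).
[cite: Balaban1985Variational, (1) p.277, Thm 1 (2),(3),(5),(6),(7),(9) pp.278–279; Balaban1985RegularSpaces, (1.3)–(1.9) p.77; Balaban1988Convergent, p.255, (2.6)–(2.8) pp.255–256, (2.12) p.256, (2.27)–(2.28) p.259, (2.38) p.261] -/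
def VariationalThm1GaugeRegSepCoP7M (M : ℕ) (B₃ B₃' a₀ a₁ : ℝ) : Prop :=
  VariationalThm1GaugeRegSepTop7M F N (fun ν K Ω => suppDomOfRecord F ν K Ω) M B₃ B₃' a₀ a₁

variable {F N}

/-- Definitional bridge to the gauge top-domain sentence at the selector of record. [cite: Balaban1985Variational, Thm 1 (9) p.279 (bookkeeping)] -/
theorem VariationalThm1GaugeRegSepCoP7M.toTop7M {M : ℕ} {B₃ B₃' a₀ a₁ : ℝ} (h : VariationalThm1GaugeRegSepCoP7M F N M B₃ B₃' a₀ a₁) :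
    VariationalThm1GaugeRegSepTop7M F N (fun ν K Ω => suppDomOfRecord F ν K Ω) M B₃ B₃' a₀ a₁ := h

/-- Conversely (definitional). [cite: Balaban1985Variational, Thm 1 (9) p.279 (bookkeeping)] -/
theorem VariationalThm1GaugeRegSepTop7M.toCoP7M {M : ℕ} {B₃ B₃' a₀ a₁ : ℝ}
    (h : VariationalThm1GaugeRegSepTop7M F N (fun ν K Ω => suppDomOfRecord F ν K Ω) M B₃ B₃' a₀ a₁) : VariationalThm1GaugeRegSepCoP7M F N M B₃ B₃' a₀ a₁ := h

/-- The gauge `CoP` sentence is ANTITONE in `a₀`, `a₁`. [cite: Balaban1985Variational, Thm 1 p.279 (the range «ε₀ ≤ a₀», «ε₁ ≤ a₁»)] -/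
theorem VariationalThm1GaugeRegSepCoP7M.of_le {M : ℕ} {B₃ B₃' a₀ a₀' a₁ a₁' : ℝ} (h : VariationalThm1GaugeRegSepCoP7M F N M B₃ B₃' a₀ a₁) (ha₀ : a₀' ≤ a₀) (ha₁ : a₁' ≤ a₁) :
    VariationalThm1GaugeRegSepCoP7M F N M B₃ B₃' a₀' a₁' :=
  VariationalThm1GaugeRegSepTop7M.of_le h ha₀ ha₁

/-- The gauge `CoP` sentence is MONOTONE in `B₃'`. [cite: Balaban1985Variational, Thm 1 (9) p.279 (bookkeeping)] -/
theorem VariationalThm1GaugeRegSepCoP7M.mono {M : ℕ} {B₃ B₃' B₃'' a₀ a₁ : ℝ} (h : VariationalThm1GaugeRegSepCoP7M F N M B₃ B₃' a₀ a₁) (hB : B₃' ≤ B₃'') :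
    VariationalThm1GaugeRegSepCoP7M F N M B₃ B₃'' a₀ a₁ :=
  VariationalThm1GaugeRegSepTop7M.mono h hB

/-- **★ def-R's COLLAR-CLASS BACKGROUND `UbgMSCoPOfRecord … s 𝐖` CARRIES THE LOCAL GAUGES OF (9) LINE 1 AT THRESHOLD `B₃'·cR·ε_n` ON BOTH CUBE FAMILIES INSIDE `Ω_n`, `1 ≤ n ≤ k`, ON THE
SOLVABLE SET**, from the gauge `CoP` sentence, for a separated sequence, `0 < M₁`, thresholds comparable both ways and a datum with print's (7) on the support (`h7`).
[cite: Balaban1985Variational, Thm 1 (2),(6),(7),(9) pp.278–279; Balaban1985RegularSpaces, (1.3) p.77; Balaban1988Convergent, (2.6)–(2.8) pp.255–256, (2.12) p.256, (2.38) p.261] -/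
theorem localGaugeOn_UbgMSCoPOfRecord_of_thm1GaugeRegSepCoP7M {M : ℕ} {B₃ B₃' a₀ a₁ : ℝ} (h15G : VariationalThm1GaugeRegSepCoP7M F N M B₃ B₃' a₀ a₁)
    (ν : Stage7Numerics) (g : ℕ → ℝ) (K k : ℕ) (cR : ℝ) (s : SeqOfRecord F ν M g K k) (hsep : Sect2.SeqSeparated ν.M₁ s) (hM₁ : 0 < ν.M₁)
    (hnum : ∀ n, n ≤ k → 0 < cR * epsOfRecord ν g n ∧ cR * epsOfRecord ν g n ≤ a₁ ∧ B₃ * (cR * epsOfRecord ν g n) ≤ ν.εreg) (ha₀ : ν.εreg ≤ a₀)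
    (hcomp : ∀ n, n < k → cR * epsOfRecord ν g n ≤ 2 * (cR * epsOfRecord ν g (n + 1)))
    (hcomp' : ∀ n, n < k → cR * epsOfRecord ν g (n + 1) ≤ 2 * (cR * epsOfRecord ν g n))
    {W : MSField (F.P K) (SU N)} (h7 : Sect2.DataSmall7PTop (avOfRecord F N K) s.Ω (suppDomOfRecord F ν K s.Ω) k (fun n => cR * epsOfRecord ν g n) W)
    (hsol : W ∈ solvableDom (avOfRecord F N K) (regMSCoPOfRecord F N ν K k s.Ω) (genSet s.Ω k)) :
    ∀ n, 1 ≤ n → n ≤ k →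
      (((B14.Eq213MaximalDomains.side (F.P K).L M n : ℕ) : ℤ) < (F.P K).sitesPerDir 0 →
        ∀ a ∈ cubeIndices (F.P K) (B14.Eq213MaximalDomains.side (F.P K).L M n),
          cubeEnl (F.P K) (B14.Eq213MaximalDomains.side (F.P K).L M n) a 0 ⊆ s.Ω n →
          Sect2.LocalGaugeOn (cubeEnl (F.P K) (B14.Eq213MaximalDomains.side (F.P K).L M n) a 0) ((F.P K).eta n) (B₃' * (cR * epsOfRecord ν g n))
            (UbgMSCoPOfRecord F N ν M g K k s W)) ∧
      (((B14.Eq213MaximalDomains.side (F.P K).L M (n + 1) : ℕ) : ℤ) < (F.P K).sitesPerDir 0 →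
        ∀ a ∈ cubeIndices (F.P K) (B14.Eq213MaximalDomains.side (F.P K).L M (n + 1)),
          cubeEnl (F.P K) (B14.Eq213MaximalDomains.side (F.P K).L M (n + 1)) a 0 ⊆ s.Ω n →
          Sect2.LocalGaugeOn (cubeEnl (F.P K) (B14.Eq213MaximalDomains.side (F.P K).L M (n + 1)) a 0) ((F.P K).eta n) (B₃' * (cR * epsOfRecord ν g n))
            (UbgMSCoPOfRecord F N ν M g K k s W)) :=
  localGaugeOn_of_thm1GaugeRegSepTop7M h15G ν g K k cR s hsep hM₁ hnum ha₀ hcomp hcomp' h7 (isMinimizer_UbgMSCoPOfRecord ν M g K k s hsol)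

/-- **★★★ ROW P11's BODY AT `(s, 𝐖)` FOR def-R's COLLAR-CLASS MINIMISER `UbgMSCoPOfRecord … s 𝐖`, FROM THE TWO CITED [15] SENTENCES OF THE `CoP` ROAD — (8) (`VariationalThm1RegSepCoP7M`,
FILE 12d) AND (9) LINE 1 (`VariationalThm1GaugeRegSepCoP7M`, §3) — PLUS PROVED GLUE, NO DISPLAYED RAW CLAUSE**: on the solvable set §2's `bgRowAtDatumU_of_thm1RegSepTop7M_of_thm1Gauge` at
`isMinimizer_UbgMSCoPOfRecord`, off it the junk `1` by FILE 10's `bgRowAtDatum_one`.  Hypotheses: the two sentences, print's (7) on the datum over the support (`h7`), the numerics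
`hnum`∕`ha₀`∕`hα`∕`hBα`, two-sided comparability, `hM₁`, (C1)(C2), the two radius letters `htI`∕`htMS`, the non-wrapping letter `hsN`.  Compared with FILE 12d :237 ∕ FILE 13 :242: the
C¹ guard `hclassC1` and the axial letters `hg`∕`hpq`∕`hΛI…`∕`htI'`∕`hΛMS…`∕`hcB`∕`hBCM`∕`hsmallI`∕`hsmallMS` are GONE (the (1.12)(c)∕(2.38)(ii) derivative members now come with the handed-over
gauge).
The shape K0a's Cut-B closer keys on. [cite: Balaban1985Variational, Thm 1 (2),(6)–(9) pp.278–279; Balaban1988Convergent, p.255, (2.6)–(2.8) pp.255–256, (2.12) p.256, (2.27)–(2.28) p.259, (2.34)–(2.41) p.261; Balaban1987RG1, (1.11)–(1.16) p.262] -/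
theorem bgRowAtDatumCoP_of_thm1RegSepCoP7M_of_thm1Gauge {M : ℕ} {B₃ B₃' a₀ a₁ : ℝ} (h15 : VariationalThm1RegSepCoP7M F N B₃ a₀ a₁)
    (h15G : VariationalThm1GaugeRegSepCoP7M F N M B₃ B₃' a₀ a₁)
    (S : Sect2.Setting (MatA N) (SU N)) (hι : S.ι = ιSU N) (h𝓜 : S.𝓜 = B12RegularSpaces111SpecialUnitary.suModel N) (hS : S.Laws) (hpos : S.Pos)
    (ν : Stage7Numerics) (hM : 0 < M) (K k : ℕ) (cR : ℝ)
    (hnum : ∀ n, n ≤ k → 0 < cR * epsOfRecord ν S.flow.g n ∧ cR * epsOfRecord ν S.flow.g n ≤ a₁ ∧ B₃ * (cR * epsOfRecord ν S.flow.g n) ≤ ν.εreg)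
    (ha₀ : ν.εreg ≤ a₀) (hcomp : ∀ n, n < k → cR * epsOfRecord ν S.flow.g n ≤ 2 * (cR * epsOfRecord ν S.flow.g (n + 1)))
    (hcomp' : ∀ n, n < k → cR * epsOfRecord ν S.flow.g (n + 1) ≤ 2 * (cR * epsOfRecord ν S.flow.g n))
    (hα : ∀ n, 1 ≤ n → n ≤ k → 0 < S.lf.alpha0 (S.flow.g n) ∧ 0 < S.lf.alpha1 (S.flow.g n))
    (hBα : ∀ n, 1 ≤ n → n ≤ k → B₃ * (cR * epsOfRecord ν S.flow.g n) ≤ (1 - S.βc) * S.lf.alpha0 (S.flow.g n))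
    (htI : ∀ n, 1 ≤ n → n ≤ k → B₃' * (cR * epsOfRecord ν S.flow.g n) ≤ S.cB * S.lf.alpha0 (S.flow.g n))
    (htMS : ∀ n, 1 ≤ n → n ≤ k → B₃' * (cR * epsOfRecord ν S.flow.g n) ≤ S.B * S.C * S.Mr * S.lf.alpha0 (S.flow.g n))
    (hC1 : ∀ j, 1 ≤ j → j ≤ k → ∃ t : ℕ, 0 < t ∧ RkOfRecord (F.P K).L ν.r (S.flow.g j) = (F.P K).L * t)
    (hC2 : ∀ j, 1 ≤ j → j ≤ k → dCubeSide (F.P K).L M (RkOfRecord (F.P K).L ν.r (S.flow.g j)) j ∣ (F.P K).sitesPerDir 0)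
    (hsN : ∀ n, 1 ≤ n → n ≤ k + 1 → ((B14.Eq213MaximalDomains.side (F.P K).L M n : ℕ) : ℤ) < (F.P K).sitesPerDir 0)
    (s : SeqOfRecord F ν M S.flow.g K k) (hsep : Sect2.SeqSeparated ν.M₁ s) (hM₁ : 0 < ν.M₁) (W : MSField (F.P K) (SU N))
    (h7 : Sect2.DataSmall7PTop (avOfRecord F N K) s.Ω (suppDomOfRecord F ν K s.Ω) k (fun n => cR * epsOfRecord ν S.flow.g n) W) :
    ∀ j, 1 ≤ j → j ≤ k → ∀ X : (Sect2.domSys (F.P K) M j).Dom,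
      (Sect2.domSites (F.P K) M j X ⊆ s.Λ j →
        Sect2.ofBackgroundC S.ι (UbgMSCoPOfRecord F N ν M S.flow.g K k s W) ∈
          Sect2.spaceI S (Sect2.Residual.unit (F.P K) (MatA N)) M j (Sect2.domSites (F.P K) M j X) (S.lf.alpha0 (S.flow.g j)) (S.lf.alpha1 (S.flow.g j))) ∧
      (Sect2.admB (F.P K) ν M S.flow.g s.Ω s.Λ j (Sect2.domSites (F.P K) M j X) = true →
        Sect2.ofBackgroundC S.ι (UbgMSCoPOfRecord F N ν M S.flow.g K k s W) ∈
          Sect2.spaceMS S (Sect2.Residual.unit (F.P K) (MatA N)) M j (Sect2.domSites (F.P K) M j X) s.Ω) := by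
  by_cases hsol : W ∈ solvableDom (avOfRecord F N K) (regMSCoPOfRecord F N ν K k s.Ω) (genSet s.Ω k)
  · exact bgRowAtDatumU_of_thm1RegSepTop7M_of_thm1Gauge h15 h15G S hι h𝓜 hS hpos ν hM K k cR hnum ha₀ hcomp hcomp' hα hBα htI htMS hC1 hC2 hsN s hsep hM₁ h7
      (isMinimizer_UbgMSCoPOfRecord ν M S.flow.g K k s hsol)
  · rw [UbgMSCoPOfRecord_eq_one_of_not_mem ν M S.flow.g K k s hsol]
    exact bgRowAtDatum_one S hpos ν M K k s hα

end AtRecordGaugeCoPM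

/-! ## §4  The gauge sentence FROM dag-n07-e's STEP fact `Gauge9RegSepTopStep` ([15] (9) line 1 for CRITICAL configurations in the class, p. 300 l. 19–21) — minimal ⇒ critical -/

section FromStep

variable {F : T4Family} {N : ℕ} [NeZero N]

/-- **★ THE GAUGE TOP-DOMAIN SENTENCE FROM THE STEP FACT**: dag-n07-e's `Gauge9RegSepTopStep F N Sup M B₃ B₃' a₀ a₁` (`Node00.CriticalOnFibreGauge`, p532575: [15] Sect. F for (9)
line 1 at the objects of record, for configurations in class (6)-Top that are CRITICAL on the fibre, `1 ≤ k`) gives §1's sentence for every MINIMISER — minimal over the open class ⇒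
critical on the fibre (`gauge9_of_isMinimizer_classTop_of_gauge9TopStep`, Fermat); the step `k = 0` is VACUOUS here (no scale `n` with `1 ≤ n ≤ 0`), so no flat-minimiser lemma is
needed (contrast `…N07Thm1Top7FromProp8` for the (8)-sentence).  The analogue of `variationalThm1RegSepTop7M_of_prop8TopStep`. [cite: Balaban1985Variational, Thm 1 (9) p.279, p.299, p.300, Prop. 8 p.304, (152) p.301, (167)–(169) pp.304–305; Balaban1988Convergent, (2.12) p.256] -/
theorem variationalThm1GaugeRegSepTop7M_of_gauge9TopStep {Sup : (ν : Stage7Numerics) → (K : ℕ) → (ℕ → Set (Site (F.P K) 0)) → Set (Site (F.P K) 0)} {M : ℕ}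
    {B₃ B₃' a₀ a₁ : ℝ} (h9 : Gauge9RegSepTopStep F N Sup M B₃ B₃' a₀ a₁) : VariationalThm1GaugeRegSepTop7M F N Sup M B₃ B₃' a₀ a₁ :=
  fun ν g K k s hsep hM₁ ε₀ δ hδ hcomp hcomp' hε₀ W h7 _ hU₀ _ hn1 hnk =>
    ⟨fun hSN _ ha hΩ => gauge9_of_isMinimizer_classTop_of_gauge9TopStep h9 ν g K k s hsep hM₁ (hn1.trans hnk) ε₀ δ hδ hcomp hcomp' hε₀ W h7 hU₀ hn1 hnk
        (Or.inl rfl) hSN ha hΩ,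
     fun hSN _ ha hΩ => gauge9_of_isMinimizer_classTop_of_gauge9TopStep h9 ν g K k s hsep hM₁ (hn1.trans hnk) ε₀ δ hδ hcomp hcomp' hε₀ W h7 hU₀ hn1 hnk
        (Or.inr rfl) hSN ha hΩ⟩

/-- **★ THE GAUGE `CoP` SENTENCE FROM THE STEP FACT** at def-R's support selector (`…CoP7M` IS `…Top7M` at `Sup := suppDomOfRecord`, definitional).
[cite: Balaban1985Variational, Thm 1 (9) p.279, Prop. 8 p.304, (152) p.301] -/
theorem variationalThm1GaugeRegSepCoP7M_of_gauge9TopStep {M : ℕ} {B₃ B₃' a₀ a₁ : ℝ}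
    (h9 : Gauge9RegSepTopStep F N (fun ν K Ω => suppDomOfRecord F ν K Ω) M B₃ B₃' a₀ a₁) : VariationalThm1GaugeRegSepCoP7M F N M B₃ B₃' a₀ a₁ :=
  (variationalThm1GaugeRegSepTop7M_of_gauge9TopStep h9).toCoP7M

end FromStep

end Literature.MathematicalPhysics.QuantumFieldTheory.Balaban1983to89.Node00

end
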